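import Literature.Topology.FourManifolds.ParamGlue
import Literature.Topology.FourManifolds.KnotReparametrisation
import Literature.Topology.FourManifolds.KnotFamilyAmbientIsotopy
import HarnessLib

/-!
# Reparametrisation tools: increasing interpolation, periodic lifts, reparametrised loops

Topic `Literature/Topology/FourManifolds` (trunk T-4MAN). Fact seat
`provefact-Literature.Topology.FourManifolds.Knot.IsConnectedSum.isIsotopic` (Schubert's theorem),
geometric heart for rail knots, tools for the assembly. Three generic tools:

* `exists_increasing_interpolation`: two increasing `C^∞` germs, at `p` and at `q > p`, with the
  value at (slightly right of) `p` below the value at (slightly left of) `q`, are joined by a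
  `C^∞` function with positive derivative (the gluing pattern of `ParamGlue.lean`);
* `exists_periodic_lift`: an increasing `C^∞` germ on a window `[w₁, w₂]` of length `< 1`, rising
  by less than one, extends to a lift of a degree-one circle diffeomorphism: `ĝ` `C^∞`, `ĝ' > 0`,
  `ĝ (t + 1) = ĝ t + 1`;
* `IsRegularLoop.comp_lift`: a regular simple loop reparametrised by such a lift is a regular
  simple loop whose knot has the same range and orientation, hence is isotopic to the original
  knot (`Knot.isIsotopic_of_range_eq_holds`).

Everything is proved; no named facts are introduced.

## References

* M. W. Hirsch, *Differential Topology*, Springer GTM 33 (1976), Ch. 8 §1. [HirschDT1976]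
-/

open scoped Manifold ContDiff Topology Real
open Function Set Metric Filter

noncomputable section

namespace Literature.Topology.FourManifolds

/-- Local notation: `𝔼 n` is the model Euclidean space `EuclideanSpace ℝ (Fin n)`. -/
local notation "𝔼 " n:arg => EuclideanSpace ℝ (Fin n)

/-- Local notation: `𝕊 n` is the unit sphere in `EuclideanSpace ℝ (Fin (n + 1))`. -/
local notation "𝕊 " n:arg => (Metric.sphere (0 : EuclideanSpace ℝ (Fin (n + 1))) 1)

attribute [local instance] fact_finrank_euclideanSpace_succ

open KnotsInBall BandData

/-! ### Increasing interpolation between two germs -/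

/-- **Increasing interpolation.** Let `g₁` be `C^∞` with positive derivative on `(a₀, a₄)` and `g₂`
on `(b₄, b₀)`, with marks `a₀ < a₁ < a₂ < a₃ < a₄`, `b₄ < b₃ < b₂ < b₁ < b₀`, `a₃ < b₃` and
`g₁ a₃ < g₂ b₃`. Then there is a `C^∞` function `φ` with positive derivative on `[a₁, b₁]`, equal to
`g₁` on `[a₁, a₂]` and to `g₂` on `[b₂, b₁]`. [folklore] -/
theorem exists_increasing_interpolation {g₁ g₂ : ℝ → ℝ} {a₀ a₁ a₂ a₃ a₄ b₄ b₃ b₂ b₁ b₀ : ℝ}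
    (h01 : a₀ < a₁) (h12 : a₁ < a₂) (h23 : a₂ < a₃) (h34 : a₃ < a₄) (hab : a₃ < b₃)
    (k43 : b₄ < b₃) (k32 : b₃ < b₂) (k21 : b₂ < b₁) (k10 : b₁ < b₀)
    (hg₁ : ∀ t ∈ Ioo a₀ a₄, ContDiffAt ℝ ∞ g₁ t ∧ 0 < deriv g₁ t)
    (hg₂ : ∀ t ∈ Ioo b₄ b₀, ContDiffAt ℝ ∞ g₂ t ∧ 0 < deriv g₂ t) (hval : g₁ a₃ < g₂ b₃) :
    ∃ φ : ℝ → ℝ, ContDiff ℝ ∞ φ ∧ (∀ t ∈ Icc a₁ b₁, 0 < deriv φ t) ∧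
      (∀ t ∈ Icc a₁ a₂, φ t = g₁ t) ∧ (∀ t ∈ Icc b₂ b₁, φ t = g₂ t) := by
  -- globalise the germs
  obtain ⟨G₁, hG₁s, hG₁eq, hG₁d, -, -, -⟩ := exists_increasing_extension_right h01 (lt_trans h12 h23) h34
    (fun t ht ↦ (hg₁ t ht).1) (fun t ht ↦ (hg₁ t ht).2)
  obtain ⟨G₂, hG₂s, hG₂eq, hG₂d, -, -, -⟩ := exists_increasing_extension_left k43 (lt_trans k32 k21) k10
    (fun t ht ↦ (hg₂ t ht).1) (fun t ht ↦ (hg₂ t ht).2)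
  have e₁ : G₁ a₃ = g₁ a₃ := hG₁eq a₃ ⟨(lt_trans h12 h23).le, le_rfl⟩
  have e₂ : G₂ b₃ = g₂ b₃ := hG₂eq b₃ ⟨le_rfl, (lt_trans k32 k21).le⟩
  -- the affine middle piece through `(a₂, g₁ a₃)` and `(b₂, g₂ b₃)`
  have hab' : a₂ < b₂ := by linarith
  set N : ℝ := (g₂ b₃ - g₁ a₃) / (b₂ - a₂) with hN
  have hN0 : 0 < N := div_pos (by linarith) (by linarith)
  set ℓ : ℝ → ℝ := fun t ↦ g₁ a₃ + N * (t - a₂) with hℓ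
  have hℓs : ContDiff ℝ ∞ ℓ := contDiff_const.add (contDiff_const.mul (contDiff_id.sub contDiff_const))
  have hℓD : ∀ t, HasDerivAt ℓ N t := fun t ↦ by
    have h := (((hasDerivAt_id t).sub_const a₂).const_mul N).const_add (g₁ a₃)
    rw [mul_one] at h; exact h
  have hℓd : ∀ t, deriv ℓ t = N := fun t ↦ (hℓD t).deriv
  have eN : N * (b₂ - a₂) = g₂ b₃ - g₁ a₃ := by rw [hN]; exact div_mul_cancel₀ _ (by linarith)
  have vℓ₁ : ℓ a₂ = g₁ a₃ := by simp [hℓ]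
  have vℓ₂ : ℓ b₂ = g₂ b₃ := by
    show g₁ a₃ + N * (b₂ - a₂) = _; rw [eN]; ring
  have hℓmono : ∀ s t, s ≤ t → ℓ s ≤ ℓ t := fun s t hst ↦ by
    show g₁ a₃ + N * (s - a₂) ≤ g₁ a₃ + N * (t - a₂)
    have := mul_le_mul_of_nonneg_left (sub_le_sub_right hst a₂) hN0.le
    linarith
  -- monotonicity of the globalised germs on the blend zones
  have hG₁mono : MonotoneOn G₁ (Icc a₂ a₃) :=
    (strictMonoOn_of_deriv_pos (convex_Icc _ _) hG₁s.continuous.continuousOn fun t ht ↦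
      hG₁d t (by rw [interior_Icc] at ht; linarith [ht.1])).monotoneOn
  have hG₂mono : MonotoneOn G₂ (Icc b₃ b₂) :=
    (strictMonoOn_of_deriv_pos (convex_Icc _ _) hG₂s.continuous.continuousOn fun t ht ↦
      hG₂d t (by rw [interior_Icc] at ht; linarith [ht.2])).monotoneOn
  -- first blend on `[a₂, a₃]`
  have hle₁ : ∀ t ∈ Icc a₂ a₃, G₁ t ≤ ℓ t := fun t ht ↦ by
    have h1 : G₁ t ≤ G₁ a₃ := hG₁mono ht ⟨h23.le, le_rfl⟩ ht.2
    have h2 : ℓ a₂ ≤ ℓ t := hℓmono _ _ ht.1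
    rw [e₁] at h1; rw [vℓ₁] at h2; linarith
  obtain ⟨H₁, hH₁s, hH₁l, hH₁r, hH₁d, -⟩ := exists_blend_deriv_pos h23 hG₁s hℓs hle₁
    (fun t ht ↦ hG₁d t (by linarith [ht.1])) (fun t _ ↦ by rw [hℓd t]; exact hN0)
  -- second blend on `[b₃, b₂]`
  have hle₂ : ∀ t ∈ Icc b₃ b₂, H₁ t ≤ G₂ t := fun t ht ↦ by
    rw [hH₁r t (by linarith [ht.1])]
    have h1 : ℓ t ≤ ℓ b₂ := hℓmono _ _ ht.2
    have h2 : G₂ b₃ ≤ G₂ t := hG₂mono ⟨le_rfl, k32.le⟩ ht ht.1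
    rw [e₂] at h2; rw [vℓ₂] at h1; linarith
  have hd₂ : ∀ t ∈ Icc b₃ b₂, 0 < deriv H₁ t := fun t ht ↦ by
    have hev : H₁ =ᶠ[𝓝 t] ℓ := by
      filter_upwards [Ioi_mem_nhds (show a₃ < t by linarith [ht.1])] with s hs using hH₁r s hs.le
    rw [hev.deriv_eq, hℓd]; exact hN0
  obtain ⟨H₂, hH₂s, hH₂l, hH₂r, hH₂d, -⟩ := exists_blend_deriv_pos k32 hH₁s hG₂s hle₂ hd₂ (fun t ht ↦ hG₂d t (by linarith [ht.2]))
  -- conclusions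
  refine ⟨H₂, hH₂s, fun t ht ↦ ?_, fun t ht ↦ ?_, fun t ht ↦ ?_⟩
  · rcases le_or_gt t a₃ with h1 | h1
    · have hev : H₂ =ᶠ[𝓝 t] H₁ := by
        filter_upwards [Iio_mem_nhds (show t < b₃ by linarith)] with s hs using hH₂l s hs.le
      rw [hev.deriv_eq]
      rcases lt_or_ge t a₂ with h2 | h2
      · have hev' : H₁ =ᶠ[𝓝 t] G₁ := by
          filter_upwards [Iio_mem_nhds h2] with s hs using hH₁l s hs.le
        rw [hev'.deriv_eq]; exact hG₁d t ht.1
      · exact hH₁d t ⟨h2, h1⟩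
    rcases lt_or_ge t b₃ with h2 | h2
    · have hev : H₂ =ᶠ[𝓝 t] ℓ := by
        filter_upwards [Iio_mem_nhds h2, Ioi_mem_nhds h1] with s hs hs'
        rw [hH₂l s hs.le, hH₁r s hs'.le]
      rw [hev.deriv_eq, hℓd]; exact hN0
    rcases le_or_gt t b₂ with h3 | h3
    · exact hH₂d t ⟨h2, h3⟩
    · have hev : H₂ =ᶠ[𝓝 t] G₂ := by
        filter_upwards [Ioi_mem_nhds h3] with s hs using hH₂r s hs.le
      rw [hev.deriv_eq]; exact hG₂d t ht.2
  · rw [hH₂l t (by linarith [ht.2]), hH₁l t ht.2, hG₁eq t ⟨ht.1, by linarith [ht.2]⟩]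
  · rw [hH₂r t ht.1, hG₂eq t ⟨by linarith [ht.1], ht.2⟩]

/-! ### Periodic lifts -/

/-- **A lift of a degree-one circle diffeomorphism**: `C^∞`, positive derivative, `ĝ (t + 1) = ĝ t + 1`.
[folklore] -/
structure IsLift (g : ℝ → ℝ) : Prop where
  contDiff : ContDiff ℝ ∞ g
  deriv_pos : ∀ t, 0 < deriv g t
  add_one : ∀ t, g (t + 1) = g t + 1

namespace IsLift

variable {g : ℝ → ℝ} (h : IsLift g)
include h

/-- A lift is strictly increasing. [folklore] -/
theorem strictMono : StrictMono g := strictMono_of_deriv_pos h.deriv_pos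

/-- Integer shifts: `g (t + m) = g t + m`. [folklore] -/
theorem add_int (t : ℝ) (m : ℤ) : g (t + m) = g t + m := by
  -- induction on `m` through naturals
  have hnat : ∀ n : ℕ, ∀ s : ℝ, g (s + n) = g s + n := by
    intro n
    induction n with
    | zero => intro s; simp
    | succ k ih => intro s; rw [Nat.cast_succ, ← add_assoc, h.add_one, ih]; ring
  obtain ⟨n, rfl | rfl⟩ := m.eq_nat_or_neg
  · exact_mod_cast hnat n t
  · have := hnat n (t + ((-(n : ℤ) : ℤ) : ℝ))
    push_cast at this ⊢
    rw [show t + -(n : ℝ) + n = t by ring] at this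
    linarith

/-- A lift is surjective. [folklore] -/
theorem surjective : Surjective g := by
  intro y
  have hc : Continuous g := h.contDiff.continuous
  -- `g (t + m) = g t + m` is unbounded in both directions
  obtain ⟨m, hm⟩ : ∃ m : ℤ, y ≤ g 0 + m := ⟨⌈y - g 0⌉, by linarith [Int.le_ceil (y - g 0)]⟩
  obtain ⟨m', hm'⟩ : ∃ m' : ℤ, g 0 + m' ≤ y := ⟨⌊y - g 0⌋, by linarith [Int.floor_le (y - g 0)]⟩
  have h1 : g (0 + m') ≤ y := by rw [h.add_int]; exact hm'
  have h2 : y ≤ g (0 + m) := by rw [h.add_int]; exact hm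
  have hle : (0 : ℝ) + m' ≤ 0 + m := by
    by_contra hlt
    have := h.strictMono (not_le.1 hlt)
    linarith
  obtain ⟨t, -, ht⟩ := intermediate_value_Icc hle hc.continuousOn ⟨h1, h2⟩
  exact ⟨t, ht⟩

/-- The derivative of a lift as a `HasDerivAt`. [folklore] -/
theorem hasDerivAt (t : ℝ) : HasDerivAt g (deriv g t) t := ((h.contDiff.differentiable (by simp)) t).hasDerivAt

end IsLift

/-- **Existence of periodic lifts with a prescribed germ on a window.** Let `w₁ < w₂` with
`w₂ + 4η < w₁ + 1 - 4η` (`η > 0`), `g` `C^∞` with positive derivative on `(w₁ - 2η, w₂ + 2η)`, and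
`g (w₂ + η) < g (w₁ - η) + 1`. Then there is a lift `ĝ` (`C^∞`, `ĝ' > 0`, `ĝ (t + 1) = ĝ t + 1`)
with `ĝ = g` on `[w₁, w₂]`. [folklore] -/
theorem exists_periodic_lift {g : ℝ → ℝ} {w₁ w₂ η : ℝ} (hη : 0 < η) (hw : w₁ < w₂) (hroom : w₂ + 4 * η < w₁ + 1 - 4 * η)
    (hg : ∀ t ∈ Ioo (w₁ - 2 * η) (w₂ + 2 * η), ContDiffAt ℝ ∞ g t ∧ 0 < deriv g t)
    (hval : g (w₂ + η) < g (w₁ - η) + 1) :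
    ∃ ĝ : ℝ → ℝ, IsLift ĝ ∧ ∀ t ∈ Icc w₁ w₂, ĝ t = g t := by
  -- the interpolation from the germ of `g` at `w₂` to the germ of `g (· - 1) + 1` at `w₁ + 1`
  set g₂ : ℝ → ℝ := fun t ↦ g (t - 1) + 1 with hg₂
  have hg₂' : ∀ t ∈ Ioo (w₁ + 1 - 2 * η) (w₂ + 1 + 2 * η), ContDiffAt ℝ ∞ g₂ t ∧ 0 < deriv g₂ t := by
    intro t ht
    obtain ⟨hs, hd⟩ := hg (t - 1) ⟨by linarith [ht.1], by linarith [ht.2]⟩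
    have hsub : HasDerivAt (fun t : ℝ ↦ t - 1) 1 t := (hasDerivAt_id t).sub_const 1
    have hc : HasDerivAt (fun t ↦ g (t - 1)) (deriv g (t - 1) * 1) t :=
      HasDerivAt.comp (h₂ := g) (h := fun t : ℝ ↦ t - 1) t ((hs.differentiableAt (by simp)).hasDerivAt) hsub
    refine ⟨(hs.comp t (contDiff_id.sub contDiff_const).contDiffAt).add contDiff_const.contDiffAt, ?_⟩
    rw [(hc.add_const 1).deriv, mul_one]; exact hd
  obtain ⟨φ, hφs, hφd, hφ1, hφ2⟩ := exists_increasing_interpolation (g₁ := g) (g₂ := g₂)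
    (a₀ := w₁ - 2 * η) (a₁ := w₁ - η) (a₂ := w₂ + η / 2) (a₃ := w₂ + η) (a₄ := w₂ + 2 * η)
    (b₄ := w₁ + 1 - 2 * η) (b₃ := w₁ + 1 - η) (b₂ := w₁ + 1 - η / 2) (b₁ := w₁ + 1 + η) (b₀ := w₁ + 1 + 2 * η)
    (by linarith) (by linarith) (by linarith) (by linarith) (by linarith) (by linarith) (by linarith) (by linarith) (by linarith)
    hg (fun t ht ↦ hg₂' t ⟨ht.1, by linarith [ht.2]⟩) (by simp only [hg₂]; rw [show w₁ + 1 - η - 1 = w₁ - η by ring]; exact hval)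
  -- the periodic correction `F = φ - id` on the fundamental domain `[w₁, w₁ + 1)`
  set F : ℝ → ℝ := fun t ↦ φ t - t with hF
  have hFs : ContDiff ℝ ∞ F := hφs.sub contDiff_id
  have hseam : ∀ t ∈ Ioo (w₁ - η / 2) (w₁ + η / 2), F (t + 1) = F t := by
    intro t ht
    simp only [hF]
    rw [hφ2 (t + 1) ⟨by linarith [ht.1], by linarith [ht.2]⟩, hφ1 t ⟨by linarith [ht.1], by linarith [ht.2]⟩, hg₂]
    ring_nf
  set ĝ : ℝ → ℝ := fun t ↦ t + periodise w₁ F t with hĝ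
  have hε : 0 < η / 2 := by positivity
  have hĝs : ContDiff ℝ ∞ ĝ := contDiff_id.add (contDiff_periodise hFs hε hseam)
  have hĝeq : ∀ t ∈ Ico w₁ (w₁ + 1), ĝ t = φ t := fun t ht ↦ by
    show t + periodise w₁ F t = φ t
    rw [periodise_eq_self w₁ F ht]
    show t + (φ t - t) = φ t
    ring
  have hĝd : ∀ t, 0 < deriv ĝ t := by
    intro t
    obtain ⟨n, hn, -, hd⟩ := deriv_periodise_eq hε hseam (F := F) t
    have hmem : t - n ∈ Ico w₁ (w₁ + 1) := hn ▸ toIcoMod_one_mem w₁ t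
    have hP : HasDerivAt (periodise w₁ F) (deriv (periodise w₁ F) t) t :=
      (((contDiff_periodise hFs hε hseam).differentiable (by simp)) t).hasDerivAt
    have hd' : HasDerivAt ĝ (1 + deriv (periodise w₁ F) t) t := (hasDerivAt_id t).add hP
    rw [hd'.deriv, hd]
    have hφ' : HasDerivAt φ (deriv φ (t - n)) (t - n) := ((hφs.differentiable (by simp)) _).hasDerivAt
    have hF' : deriv F (t - n) = deriv φ (t - n) - 1 := by
      have hF'' : HasDerivAt F (deriv φ (t - n) - 1) (t - n) := hφ'.sub (hasDerivAt_id _)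
      exact hF''.deriv
    rw [hF']
    have := hφd (t - n) ⟨by linarith [hmem.1], by linarith [hmem.2]⟩
    linarith
  have hĝp : ∀ t, ĝ (t + 1) = ĝ t + 1 := fun t ↦ by
    simp only [hĝ]; rw [(periodic_periodise w₁ F) t]; ring
  refine ⟨ĝ, ⟨hĝs, hĝd, hĝp⟩, fun t ht ↦ ?_⟩
  rw [hĝeq t ⟨ht.1, by linarith [ht.2]⟩, hφ1 t ⟨by linarith [ht.1], by linarith [ht.2]⟩]

/-! ### Reparametrised loops -/

namespace IsRegularLoop

variable {c : ℝ → 𝔼 4} (h : IsRegularLoop c) {g : ℝ → ℝ} (hg : IsLift g)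
include h hg

/-- **A regular loop reparametrised by a lift is a regular loop.** [folklore] -/
theorem comp_lift : IsRegularLoop (c ∘ g) where
  contDiff := h.contDiff.comp hg.contDiff
  periodic t := by show c (g (t + 1)) = c (g t); rw [hg.add_one, h.periodic]
  norm_eq_one t := h.norm_eq_one _
  deriv_ne_zero t := by
    have hc : HasDerivAt c (deriv c (g t)) (g t) := ((h.contDiff.differentiable (by simp)) _).hasDerivAt
    have hd : HasDerivAt (c ∘ g) (deriv g t • deriv c (g t)) t := hc.scomp t (hg.hasDerivAt t)
    rw [hd.deriv]
    exact smul_ne_zero (hg.deriv_pos t).ne' (h.deriv_ne_zero _)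

omit h in
/-- **Simplicity is preserved**: if `c` identifies only parameters differing by integers, so does
`c ∘ g`. [folklore] -/
theorem simple_comp_lift (hinj : ∀ s t, c s = c t → ∃ m : ℤ, t - s = m) :
    ∀ s t, (c ∘ g) s = (c ∘ g) t → ∃ m : ℤ, t - s = m := by
  intro s t hst
  obtain ⟨m, hm⟩ := hinj (g s) (g t) hst
  refine ⟨m, ?_⟩
  have h1 : g t = g (s + m) := by rw [hg.add_int]; linarith
  have h2 : t = s + m := hg.strictMono.injective h1
  linarith

/-- **The knot of the reparametrised loop has the same range.** [folklore] -/
theorem range_toKnot_comp_lift (hinj : ∀ s t, c s = c t → ∃ m : ℤ, t - s = m) :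
    range ((h.comp_lift hg).toKnot (simple_comp_lift hg hinj)) = range (h.toKnot hinj) := by
  have e1 := (h.comp_lift hg).image_coe_range_toKnot (simple_comp_lift hg hinj)
  have e2 := h.image_coe_range_toKnot hinj
  have e3 : range (c ∘ g) = range c := hg.surjective.range_comp c
  rw [e3, ← e2] at e1
  exact Subtype.val_injective.image_injective e1

/-- **The knot of the reparametrised loop induces the same orientation.** [folklore] -/
theorem sameOrientationAt_toKnot_comp_lift (hinj : ∀ s t, c s = c t → ∃ m : ℤ, t - s = m) :
    Knot.SameOrientationAt ((h.comp_lift hg).toKnot (simple_comp_lift hg hinj)) (h.toKnot hinj) := by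
  have hπ : 0 < 2 * π := by positivity
  refine ⟨0, 2 * π * g 0, deriv g 0, hg.deriv_pos 0, ?_, ?_⟩
  · apply Subtype.ext
    rw [(h.comp_lift hg).coe_toKnot_circlePoint, h.coe_toKnot_circlePoint]
    show c (g ((2 * π)⁻¹ * 0)) = c ((2 * π)⁻¹ * (2 * π * g 0))
    rw [mul_zero, ← mul_assoc, inv_mul_cancel₀ hπ.ne', one_mul]
  · have e1 : (fun t ↦ (((h.comp_lift hg).toKnot (simple_comp_lift hg hinj) (circlePoint t) : 𝕊 3) : 𝔼 4)) =
        fun t ↦ c (g ((2 * π)⁻¹ * t)) := funext fun t ↦ (h.comp_lift hg).coe_toKnot_circlePoint _ t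
    have e2 : (fun t ↦ ((h.toKnot hinj (circlePoint t) : 𝕊 3) : 𝔼 4)) = fun t ↦ c ((2 * π)⁻¹ * t) :=
      funext fun t ↦ h.coe_toKnot_circlePoint _ t
    rw [e1, e2]
    have hlin : ∀ t, HasDerivAt (fun t : ℝ ↦ (2 * π)⁻¹ * t) (2 * π)⁻¹ t := fun t ↦ by
      simpa using (hasDerivAt_id t).const_mul (2 * π)⁻¹
    have hc : ∀ s, HasDerivAt c (deriv c s) s := fun s ↦ ((h.contDiff.differentiable (by simp)) _).hasDerivAt
    -- left: at `t = 0`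
    have hL : HasDerivAt (fun t ↦ c (g ((2 * π)⁻¹ * t))) (((2 * π)⁻¹ * deriv g 0) • deriv c (g 0)) 0 := by
      have hg0 : HasDerivAt g (deriv g 0) ((fun t : ℝ ↦ (2 * π)⁻¹ * t) 0) := by
        show HasDerivAt g (deriv g 0) ((2 * π)⁻¹ * 0); rw [mul_zero]; exact hg.hasDerivAt 0
      have hin : HasDerivAt (fun t ↦ g ((2 * π)⁻¹ * t)) (deriv g 0 * (2 * π)⁻¹) 0 :=
        HasDerivAt.comp (h₂ := g) (h := fun t : ℝ ↦ (2 * π)⁻¹ * t) 0 hg0 (hlin 0)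
      have hc0 : HasDerivAt c (deriv c (g 0)) ((fun t ↦ g ((2 * π)⁻¹ * t)) 0) := by
        show HasDerivAt c (deriv c (g 0)) (g ((2 * π)⁻¹ * 0)); rw [mul_zero]; exact hc (g 0)
      have := HasDerivAt.scomp (g₁ := c) (h := fun t ↦ g ((2 * π)⁻¹ * t)) 0 hc0 hin
      rw [show deriv g 0 * (2 * π)⁻¹ = (2 * π)⁻¹ * deriv g 0 by ring] at this
      exact this
    -- right: at `t = 2π g 0`
    have hR : HasDerivAt (fun t ↦ c ((2 * π)⁻¹ * t)) ((2 * π)⁻¹ • deriv c (g 0)) (2 * π * g 0) := by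
      have e : (2 * π)⁻¹ * (2 * π * g 0) = g 0 := by field_simp
      have := HasDerivAt.scomp (g₁ := c) (h := fun t : ℝ ↦ (2 * π)⁻¹ * t) (2 * π * g 0) (by rw [e]; exact hc (g 0)) (hlin _)
      exact this
    rw [hL.deriv, hR.deriv, smul_smul, mul_comm]

/-- **THE REPARAMETRISED KNOT IS ISOTOPIC TO THE ORIGINAL.**
[cite: HirschDT1976, Ch. 8, Thm. 8.1.3 (p. 180) and proof of Thm. 8.3.3 (p. 186)] -/
theorem isIsotopic_toKnot_comp_lift (hinj : ∀ s t, c s = c t → ∃ m : ℤ, t - s = m) :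
    ((h.comp_lift hg).toKnot (simple_comp_lift hg hinj)).IsIsotopic (h.toKnot hinj) :=
  Knot.isIsotopic_of_range_eq_holds (h.range_toKnot_comp_lift hg hinj) (h.sameOrientationAt_toKnot_comp_lift hg hinj)

end IsRegularLoop

end Literature.Topology.FourManifolds
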